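import Literature.MathematicalPhysics.QuantumFieldTheory.CubicalChainsHodge
import Mathlib.Topology.Algebra.InfiniteSum.Real
import Mathlib.Algebra.FiniteSupport.Basic
import HarnessLib

/-!
# Cubical chains on `ℤ^d`: the `ℓ²` pairings, summation by parts `⟪∂T, S⟫ = ⟪T, dS⟫`, and the
variational bound `‖σ - ∂f‖² ≤ ‖σ‖² - (2⟪d₂σ, f⟫ - E(f))`

Support file for the lattice potential theory of the four-dimensional `U(1)` gauge theory (proof
programme of the named fact
`Literature.MathematicalPhysics.QuantumFieldTheory.FrohlichSpencerU1PerimeterLawD4`;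
Fröhlich–Spencer 1982 §2.3 (2.14)–(2.15): the inner product of `k`-forms and "summation by parts"
`(α, δβ) = (dα, β)`; §2.7/§2.10: the Coulomb 2-form `ε_Λ` of a Wilson loop, orthogonal to the
closed forms (2.52), whose energy `(ε_Λ, ε_Λ)` controls the perimeter bound (2.88)). Everything is
proved; no named fact is introduced.

For REAL tensors on `ℤ^d` with finite support in the site variable (Mathlib's
`Function.HasFiniteSupport`) we define the normalised pairings `pair₁ = ∑`, `pair₂ = ½ ∑`,
`pair₃ = ⅙ ∑`, `pair₄ = (1/24) ∑` (site sums as `tsum`s of finitely supported families, inner sums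
over all index tuples, so that each cell of an alternating tensor is counted once), and prove

* **summation by parts** (Fröhlich–Spencer (2.15)): `pair₁_div₂ : ⟪∂M, φ⟫₁ = ⟪M, d₁φ⟫₂`
  (`M` alternating), `pair₂_div₃ : ⟪∂Q, M⟫₂ = ⟪Q, d₂M⟫₃` (`Q` totally alternating),
  `pair₃_div₄ : ⟪∂P, Q⟫₃ = ⟪P, cd₃Q⟫₄` (`P` totally alternating);
* `energy₃_eq` (from the Hodge identity of `CubicalChainsHodge`):
  `⟪f, -Δf⟫₃ = ⟪∂f, ∂f⟫₂ + ⟪cd₃ f, cd₃ f⟫₄`, whence `pair₂_div₃_self_le_energy₃ : ‖∂f‖² ≤ ⟪f, -Δf⟫₃`;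
* `pair₂_sub_div₃_self_le` (**the variational bound**): for a finitely supported alternating real
  2-chain `σ` and a finitely supported totally alternating real 3-chain `f`,
  `⟪σ - ∂f, σ - ∂f⟫₂ ≤ ⟪σ, σ⟫₂ - (2⟪f, d₂σ⟫₃ - ⟪f, -Δf⟫₃)`.
  With `σ` the sheet of a Wilson loop and `f` supported in the box `Λ`, the left side dominates
  Fröhlich–Spencer's `(ε_Λ, ε_Λ)` (`ε_Λ` = the minimal-norm element of `σ + {closed 2-chains in Λ}`,
  the closed chains in a box being exactly the `∂f`, `CubicalChainsPoincare`), so that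
  `(ε_Λ, ε_Λ) ≤ const (L+T)` ((2.88)) reduces to exhibiting one good test 3-chain `f`.

## References

* J. Fröhlich, T. Spencer, Comm. Math. Phys. 83 (1982) 411–454, §2.3 (2.14)–(2.16), §2.7
  (2.50)–(2.52), §2.10 (2.88). [FrohlichSpencerCMP1982]
-/

open Finset Function Literature.Probability.LatticeModels

noncomputable section

namespace Literature.MathematicalPhysics.QuantumFieldTheory

namespace LatticeChain

open LatticeForm (e d₁ d₂)

variable {d : ℕ}

/-! ### Finitely supported families on `ℤ^d` -/

/-- A family vanishing wherever a finitely supported family vanishes is finitely supported. [folklore] -/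
theorem hasFiniteSupport_of_imp {β γ : Type*} [Zero β] [Zero γ] {T : Site d → β}
    (h : HasFiniteSupport T) {S : Site d → γ} (hS : ∀ y, T y = 0 → S y = 0) : HasFiniteSupport S :=
  h.subset fun y hy => by
    simp only [Function.mem_support, ne_eq] at hy ⊢
    exact fun h0 => hy (hS y h0)

/-- Shifting the site variable preserves finite support. [folklore] -/
theorem hasFiniteSupport_comp_sub {β : Type*} [Zero β] {T : Site d → β} (h : HasFiniteSupport T)
    (a : Site d) : HasFiniteSupport fun y => T (y - a) := by
  refine (h.image fun y => y + a).subset fun y hy => ?_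
  simp only [Function.mem_support, ne_eq, Set.mem_image] at hy ⊢
  exact ⟨y - a, hy, sub_add_cancel y a⟩

/-- Shifting the site variable the other way preserves finite support. [folklore] -/
theorem hasFiniteSupport_comp_add {β : Type*} [Zero β] {T : Site d → β} (h : HasFiniteSupport T)
    (a : Site d) : HasFiniteSupport fun y => T (y + a) := by
  simpa using hasFiniteSupport_comp_sub h (-a)

/-- A family which vanishes wherever a finitely supported tensor and all its backward shifts
`T (y - eⱼ)` vanish is finitely supported. [folklore] -/
theorem hasFiniteSupport_of_imp_sub {β γ : Type*} [Zero β] [Zero γ] {T : Site d → β}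
    (h : HasFiniteSupport T) {S : Site d → γ}
    (hS : ∀ y, T y = 0 → (∀ j : Fin d, T (y - e j) = 0) → S y = 0) : HasFiniteSupport S := by
  refine (h.union (Set.finite_iUnion fun j : Fin d => hasFiniteSupport_comp_sub h (e j))).subset
    fun y hy => ?_
  simp only [Function.mem_support, ne_eq, Set.mem_union, Set.mem_iUnion] at hy ⊢
  by_contra hcon
  push Not at hcon
  exact hy (hS y hcon.1 hcon.2)

/-- A family which vanishes wherever a finitely supported tensor and all its forward shifts
`T (y + eⱼ)` vanish is finitely supported. [folklore] -/
theorem hasFiniteSupport_of_imp_add {β γ : Type*} [Zero β] [Zero γ] {T : Site d → β}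
    (h : HasFiniteSupport T) {S : Site d → γ}
    (hS : ∀ y, T y = 0 → (∀ j : Fin d, T (y + e j) = 0) → S y = 0) : HasFiniteSupport S := by
  refine (h.union (Set.finite_iUnion fun j : Fin d => hasFiniteSupport_comp_add h (e j))).subset
    fun y hy => ?_
  simp only [Function.mem_support, ne_eq, Set.mem_union, Set.mem_iUnion] at hy ⊢
  by_contra hcon
  push Not at hcon
  exact hy (hS y hcon.1 hcon.2)

/-- Shifting each term of a finite family of finitely supported site families by its own lattice
vector does not change the total: `∑' y, ∑ⱼ gⱼ(y - eⱼ) = ∑' y, ∑ⱼ gⱼ(y)`. [folklore] -/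
theorem tsum_sum_comp_sub_e {g : Fin d → Site d → ℝ} (hg : ∀ j, HasFiniteSupport (g j)) :
    ∑' y, ∑ j, g j (y - e j) = ∑' y, ∑ j, g j y := by
  rw [Summable.tsum_finsetSum fun j _ =>
      summable_of_hasFiniteSupport (hasFiniteSupport_comp_sub (hg j) (e j)),
    Summable.tsum_finsetSum fun j _ => summable_of_hasFiniteSupport (hg j)]
  exact Finset.sum_congr rfl fun j _ => (Equiv.subRight (e j)).tsum_eq (g j)

/-! ### Alternating real tensors and index renamings -/

/-- Alternating real 2-tensors. [folklore] -/
def IsAltR₂ (M : Site d → Fin d → Fin d → ℝ) : Prop := ∀ y i j, M y j i = -M y i j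

/-- Totally alternating real 3-tensors. [folklore] -/
def IsAltR₃ (Q : Site d → Fin d → Fin d → Fin d → ℝ) : Prop :=
  (∀ y i j k, Q y j i k = -Q y i j k) ∧ ∀ y i j k, Q y i k j = -Q y i j k

/-- Totally alternating real 4-tensors (adjacent transpositions). [folklore] -/
def IsAltR₄ (P : Site d → Fin d → Fin d → Fin d → Fin d → ℝ) : Prop :=
  (∀ y i j k l, P y j i k l = -P y i j k l) ∧ (∀ y i j k l, P y i k j l = -P y i j k l) ∧
    ∀ y i j k l, P y i j l k = -P y i j k l

/-- Renaming `(i,j) ↦ (j,i)` against an alternating 2-tensor flips the sign. [folklore] -/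
theorem sum₂_swap {M : Site d → Fin d → Fin d → ℝ} (h : IsAltR₂ M) (y : Site d)
    (F : Fin d → Fin d → ℝ) : ∑ i, ∑ j, M y i j * F j i = -∑ i, ∑ j, M y i j * F i j := by
  rw [Finset.sum_comm, ← Finset.sum_neg_distrib]
  refine Finset.sum_congr rfl fun i _ => ?_
  rw [← Finset.sum_neg_distrib]
  exact Finset.sum_congr rfl fun j _ => by rw [h y i j]; ring

/-- Renaming swapping the first two indices against a totally alternating 3-tensor. [folklore] -/
theorem sum₃_swap₁₂ {Q : Site d → Fin d → Fin d → Fin d → ℝ} (h : IsAltR₃ Q) (y : Site d)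
    (F : Fin d → Fin d → Fin d → ℝ) :
    ∑ j, ∑ k, ∑ l, Q y j k l * F k j l = -∑ j, ∑ k, ∑ l, Q y j k l * F j k l := by
  rw [Finset.sum_comm, ← Finset.sum_neg_distrib]
  refine Finset.sum_congr rfl fun j _ => ?_
  rw [← Finset.sum_neg_distrib]
  refine Finset.sum_congr rfl fun k _ => ?_
  rw [← Finset.sum_neg_distrib]
  exact Finset.sum_congr rfl fun l _ => by rw [h.1 y j k l]; ring

/-- Renaming swapping the last two indices against a totally alternating 3-tensor. [folklore] -/
theorem sum₃_swap₂₃ {Q : Site d → Fin d → Fin d → Fin d → ℝ} (h : IsAltR₃ Q) (y : Site d)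
    (F : Fin d → Fin d → Fin d → ℝ) :
    ∑ j, ∑ k, ∑ l, Q y j k l * F j l k = -∑ j, ∑ k, ∑ l, Q y j k l * F j k l := by
  rw [← Finset.sum_neg_distrib]
  refine Finset.sum_congr rfl fun j _ => ?_
  rw [Finset.sum_comm, ← Finset.sum_neg_distrib]
  refine Finset.sum_congr rfl fun k _ => ?_
  rw [← Finset.sum_neg_distrib]
  exact Finset.sum_congr rfl fun l _ => by rw [h.2 y j k l]; ring

/-- The cyclic renaming `(j,k,l) ↦ (k,l,j)` against a totally alternating 3-tensor. [folklore] -/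
theorem sum₃_cyclic {Q : Site d → Fin d → Fin d → Fin d → ℝ} (h : IsAltR₃ Q) (y : Site d)
    (F : Fin d → Fin d → Fin d → ℝ) :
    ∑ j, ∑ k, ∑ l, Q y j k l * F k l j = ∑ j, ∑ k, ∑ l, Q y j k l * F j k l := by
  have h1 := sum₃_swap₁₂ h y (fun a b c => F a c b)
  have h2 := sum₃_swap₂₃ h y F
  rw [h1, h2, neg_neg]

/-- The cyclic renaming `(j,k,l) ↦ (l,j,k)` against a totally alternating 3-tensor. [folklore] -/
theorem sum₃_cyclic' {Q : Site d → Fin d → Fin d → Fin d → ℝ} (h : IsAltR₃ Q) (y : Site d)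
    (F : Fin d → Fin d → Fin d → ℝ) :
    ∑ j, ∑ k, ∑ l, Q y j k l * F l j k = ∑ j, ∑ k, ∑ l, Q y j k l * F j k l := by
  have h1 := sum₃_cyclic h y (fun a b c => F c a b)
  exact h1.symm

/-- Renaming swapping the first two indices against a totally alternating 4-tensor. [folklore] -/
theorem sum₄_swap₁₂ {P : Site d → Fin d → Fin d → Fin d → Fin d → ℝ} (h : IsAltR₄ P) (y : Site d)
    (F : Fin d → Fin d → Fin d → Fin d → ℝ) :
    ∑ i, ∑ j, ∑ k, ∑ l, P y i j k l * F j i k l = -∑ i, ∑ j, ∑ k, ∑ l, P y i j k l * F i j k l := by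
  rw [Finset.sum_comm, ← Finset.sum_neg_distrib]
  refine Finset.sum_congr rfl fun i _ => ?_
  rw [← Finset.sum_neg_distrib]
  refine Finset.sum_congr rfl fun j _ => ?_
  rw [← Finset.sum_neg_distrib]
  refine Finset.sum_congr rfl fun k _ => ?_
  rw [← Finset.sum_neg_distrib]
  exact Finset.sum_congr rfl fun l _ => by rw [h.1 y i j k l]; ring

/-- Renaming swapping the middle two indices against a totally alternating 4-tensor. [folklore] -/
theorem sum₄_swap₂₃ {P : Site d → Fin d → Fin d → Fin d → Fin d → ℝ} (h : IsAltR₄ P) (y : Site d)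
    (F : Fin d → Fin d → Fin d → Fin d → ℝ) :
    ∑ i, ∑ j, ∑ k, ∑ l, P y i j k l * F i k j l = -∑ i, ∑ j, ∑ k, ∑ l, P y i j k l * F i j k l := by
  rw [← Finset.sum_neg_distrib]
  refine Finset.sum_congr rfl fun i _ => ?_
  rw [Finset.sum_comm, ← Finset.sum_neg_distrib]
  refine Finset.sum_congr rfl fun j _ => ?_
  rw [← Finset.sum_neg_distrib]
  refine Finset.sum_congr rfl fun k _ => ?_
  rw [← Finset.sum_neg_distrib]
  exact Finset.sum_congr rfl fun l _ => by rw [h.2.1 y i j k l]; ring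

/-- Renaming swapping the last two indices against a totally alternating 4-tensor. [folklore] -/
theorem sum₄_swap₃₄ {P : Site d → Fin d → Fin d → Fin d → Fin d → ℝ} (h : IsAltR₄ P) (y : Site d)
    (F : Fin d → Fin d → Fin d → Fin d → ℝ) :
    ∑ i, ∑ j, ∑ k, ∑ l, P y i j k l * F i j l k = -∑ i, ∑ j, ∑ k, ∑ l, P y i j k l * F i j k l := by
  rw [← Finset.sum_neg_distrib]
  refine Finset.sum_congr rfl fun i _ => ?_
  rw [← Finset.sum_neg_distrib]
  refine Finset.sum_congr rfl fun j _ => ?_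
  rw [Finset.sum_comm, ← Finset.sum_neg_distrib]
  refine Finset.sum_congr rfl fun k _ => ?_
  rw [← Finset.sum_neg_distrib]
  exact Finset.sum_congr rfl fun l _ => by rw [h.2.2 y i j k l]; ring

/-! ### The pairings -/

/-- `⟪φ, ψ⟫₁ = ∑_y ∑_k φ(y,k) ψ(y,k)`. [cite: FrohlichSpencerCMP1982, §2.3 (2.14)] -/
def pair₁ (φ ψ : Site d → Fin d → ℝ) : ℝ := ∑' y, ∑ k, φ y k * ψ y k

/-- `⟪M, N⟫₂ = ½ ∑_y ∑_{k,l} M N` (each plaquette of an alternating tensor counted once).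
[cite: FrohlichSpencerCMP1982, §2.3 (2.14)] -/
def pair₂ (M N : Site d → Fin d → Fin d → ℝ) : ℝ := (1 / 2) * ∑' y, ∑ k, ∑ l, M y k l * N y k l

/-- `⟪Q, P⟫₃ = ⅙ ∑_y ∑_{j,k,l} Q P`. [cite: FrohlichSpencerCMP1982, §2.3 (2.14)] -/
def pair₃ (Q P : Site d → Fin d → Fin d → Fin d → ℝ) : ℝ :=
  (1 / 6) * ∑' y, ∑ j, ∑ k, ∑ l, Q y j k l * P y j k l

/-- `⟪P, P'⟫₄ = (1/24) ∑_y ∑_{i,j,k,l} P P'`. [cite: FrohlichSpencerCMP1982, §2.3 (2.14)] -/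
def pair₄ (P P' : Site d → Fin d → Fin d → Fin d → Fin d → ℝ) : ℝ :=
  (1 / 24) * ∑' y, ∑ i, ∑ j, ∑ k, ∑ l, P y i j k l * P' y i j k l

/-- `pair₂` is symmetric. [folklore] -/
theorem pair₂_comm (M N : Site d → Fin d → Fin d → ℝ) : pair₂ M N = pair₂ N M := by
  simp only [pair₂, mul_comm (M _ _ _)]

/-- `pair₃` is symmetric. [folklore] -/
theorem pair₃_comm (Q P : Site d → Fin d → Fin d → Fin d → ℝ) : pair₃ Q P = pair₃ P Q := by
  simp only [pair₃, mul_comm (Q _ _ _ _)]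

/-- `⟪P, P⟫₄ ≥ 0`. [folklore] -/
theorem pair₄_self_nonneg (P : Site d → Fin d → Fin d → Fin d → Fin d → ℝ) : 0 ≤ pair₄ P P := by
  unfold pair₄
  refine mul_nonneg (by norm_num) (tsum_nonneg fun y => ?_)
  exact Finset.sum_nonneg fun i _ => Finset.sum_nonneg fun j _ => Finset.sum_nonneg fun k _ =>
    Finset.sum_nonneg fun l _ => mul_self_nonneg _

/-- The summand family of `pair₂ M N` is finitely supported when `M` is. [folklore] -/
theorem hasFiniteSupport_pair₂_summand {M : Site d → Fin d → Fin d → ℝ} (hM : HasFiniteSupport M)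
    (N : Site d → Fin d → Fin d → ℝ) : HasFiniteSupport fun y => ∑ k, ∑ l, M y k l * N y k l :=
  hasFiniteSupport_of_imp hM fun y h0 => by simp [h0]

/-- The summand family of `pair₃ Q P` is finitely supported when `Q` is. [folklore] -/
theorem hasFiniteSupport_pair₃_summand {Q : Site d → Fin d → Fin d → Fin d → ℝ}
    (hQ : HasFiniteSupport Q) (P : Site d → Fin d → Fin d → Fin d → ℝ) :
    HasFiniteSupport fun y => ∑ j, ∑ k, ∑ l, Q y j k l * P y j k l :=
  hasFiniteSupport_of_imp hQ fun y h0 => by simp [h0]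

/-- `pair₂` is additive in the second slot (finitely supported first slot). [folklore] -/
theorem pair₂_add_right {M : Site d → Fin d → Fin d → ℝ} (hM : HasFiniteSupport M)
    (N N' : Site d → Fin d → Fin d → ℝ) : pair₂ M (N + N') = pair₂ M N + pair₂ M N' := by
  unfold pair₂
  rw [← mul_add, ← Summable.tsum_add (summable_of_hasFiniteSupport (hasFiniteSupport_pair₂_summand hM N))
    (summable_of_hasFiniteSupport (hasFiniteSupport_pair₂_summand hM N'))]
  congr 1
  refine tsum_congr fun y => ?_
  simp only [Pi.add_apply, mul_add, Finset.sum_add_distrib]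

/-- `pair₂` is subtractive in the second slot (finitely supported first slot). [folklore] -/
theorem pair₂_sub_right {M : Site d → Fin d → Fin d → ℝ} (hM : HasFiniteSupport M)
    (N N' : Site d → Fin d → Fin d → ℝ) : pair₂ M (N - N') = pair₂ M N - pair₂ M N' := by
  unfold pair₂
  rw [← mul_sub, ← Summable.tsum_sub (summable_of_hasFiniteSupport (hasFiniteSupport_pair₂_summand hM N))
    (summable_of_hasFiniteSupport (hasFiniteSupport_pair₂_summand hM N'))]
  congr 1
  refine tsum_congr fun y => ?_
  simp only [Pi.sub_apply, mul_sub, Finset.sum_sub_distrib]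

/-- `pair₃` is additive in the second slot (finitely supported first slot). [folklore] -/
theorem pair₃_add_right {Q : Site d → Fin d → Fin d → Fin d → ℝ} (hQ : HasFiniteSupport Q)
    (P P' : Site d → Fin d → Fin d → Fin d → ℝ) : pair₃ Q (P + P') = pair₃ Q P + pair₃ Q P' := by
  unfold pair₃
  rw [← mul_add, ← Summable.tsum_add (summable_of_hasFiniteSupport (hasFiniteSupport_pair₃_summand hQ P))
    (summable_of_hasFiniteSupport (hasFiniteSupport_pair₃_summand hQ P'))]
  congr 1
  refine tsum_congr fun y => ?_
  simp only [Pi.add_apply, mul_add, Finset.sum_add_distrib]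

/-! ### Finite support of derived tensors -/

/-- The divergence of a finitely supported 3-tensor is finitely supported. [folklore] -/
theorem hasFiniteSupport_div₃ {Q : Site d → Fin d → Fin d → Fin d → ℝ} (hQ : HasFiniteSupport Q) :
    HasFiniteSupport (div₃ Q) :=
  hasFiniteSupport_of_imp_sub hQ fun y h0 h1 => by
    funext k l
    simp only [LatticeChain.div₃, Pi.zero_apply]
    exact Finset.sum_eq_zero fun j _ => by rw [h0, h1 j]; simp

/-- The coboundary `d₂` of a finitely supported 2-tensor is finitely supported. [folklore] -/
theorem hasFiniteSupport_d₂ {M : Site d → Fin d → Fin d → ℝ} (hM : HasFiniteSupport M) :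
    HasFiniteSupport (d₂ M) :=
  hasFiniteSupport_of_imp_add hM fun y h0 h1 => by
    funext i j k
    simp only [LatticeForm.d₂, Pi.zero_apply, h0, h1 i, h1 j, h1 k]
    simp

/-- The coboundary `cd₃` of a finitely supported 3-tensor is finitely supported. [folklore] -/
theorem hasFiniteSupport_cd₃ {Q : Site d → Fin d → Fin d → Fin d → ℝ} (hQ : HasFiniteSupport Q) :
    HasFiniteSupport (cd₃ Q) :=
  hasFiniteSupport_of_imp_add hQ fun y h0 h1 => by
    funext i j k l
    simp only [LatticeChain.cd₃, Pi.zero_apply, h0, h1 i, h1 j, h1 k, h1 l]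
    simp

/-- `negLap₃` of a finitely supported 3-tensor is finitely supported. [folklore] -/
theorem hasFiniteSupport_negLap₃ {Q : Site d → Fin d → Fin d → Fin d → ℝ} (hQ : HasFiniteSupport Q) :
    HasFiniteSupport (negLap₃ Q) := by
  have h := div₄_cd₃_add_d₂_div₃ Q
  rw [← h]
  refine (Function.HasFiniteSupport.add ?_ ?_)
  · exact hasFiniteSupport_of_imp_sub (hasFiniteSupport_cd₃ hQ) fun y h0 h1 => by
      funext j k l
      simp only [LatticeChain.div₄, Pi.zero_apply]
      exact Finset.sum_eq_zero fun i _ => by rw [h0, h1 i]; simp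
  · exact hasFiniteSupport_d₂ (hasFiniteSupport_div₃ hQ)

/-! ### Summation by parts -/

/-- **Summation by parts, degree `2 → 1`**: `⟪∂M, φ⟫₁ = ⟪M, d₁φ⟫₂` for a finitely supported
alternating real 2-chain `M` and any 1-tensor `φ`. [cite: FrohlichSpencerCMP1982, §2.3 (2.15)] -/
theorem pair₁_div₂ {M : Site d → Fin d → Fin d → ℝ} (hM : HasFiniteSupport M) (halt : IsAltR₂ M)
    (φ : Site d → Fin d → ℝ) : pair₁ (div₂ M) φ = pair₂ M (d₁ φ) := by
  -- the two finitely supported families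
  set A : Site d → ℝ := fun y => ∑ i, ∑ j, M y i j * φ y i with hA
  set g : Fin d → Site d → ℝ := fun i z => ∑ j, M z i j * φ (z + e i) j with hg
  have hsA : HasFiniteSupport A := hasFiniteSupport_of_imp hM fun y h0 => by simp [hA, h0]
  have hsg : ∀ i, HasFiniteSupport (g i) := fun i => hasFiniteSupport_of_imp hM fun y h0 => by
    simp [hg, h0]
  have hsC : HasFiniteSupport fun y => ∑ i, g i y :=
    hasFiniteSupport_of_imp hM fun y h0 => by simp [hg, h0]
  have hsB : HasFiniteSupport fun y => ∑ i, g i (y - e i) :=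
    hasFiniteSupport_of_imp_sub hM fun y _ h1 => Finset.sum_eq_zero fun i _ => by simp [hg, h1 i]
  -- the right side
  have hR : pair₂ M (d₁ φ) = ∑' y, (A y + ∑ i, g i y) := by
    unfold pair₂
    rw [← tsum_mul_left]
    refine tsum_congr fun y => ?_
    have h1 : ∑ i, ∑ j, M y i j * d₁ φ y i j =
        ∑ i, ∑ j, M y i j * φ y i + ∑ i, ∑ j, M y i j * φ (y + e i) j -
          ∑ i, ∑ j, M y i j * φ (y + e j) i - ∑ i, ∑ j, M y i j * φ y j := by
      simp only [LatticeForm.d₁, mul_add, mul_sub, Finset.sum_add_distrib, Finset.sum_sub_distrib]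
    have h2 := sum₂_swap halt y (fun a b => φ (y + e a) b)
    have h3 := sum₂_swap halt y (fun a _ => φ y a)
    rw [h1, h2, h3, hA, hg]
    ring
  -- the left side
  have hL : pair₁ (div₂ M) φ = ∑' y, (A y + ∑ i, g i (y - e i)) := by
    unfold pair₁
    refine tsum_congr fun y => ?_
    simp only [LatticeChain.div₂, Finset.sum_mul, sub_mul, Finset.sum_sub_distrib]
    have h1 : ∑ k, ∑ j, M y j k * φ y k = -A y := by
      rw [hA, ← Finset.sum_neg_distrib]
      refine Finset.sum_congr rfl fun k _ => ?_
      rw [← Finset.sum_neg_distrib]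
      exact Finset.sum_congr rfl fun j _ => by rw [halt y k j]; ring
    have h2 : ∑ k, ∑ j, M (y - e j) j k * φ y k = ∑ i, g i (y - e i) := by
      rw [Finset.sum_comm]
      refine Finset.sum_congr rfl fun j _ => ?_
      simp only [hg, sub_add_cancel]
    rw [h1, h2]
    ring
  rw [hL, hR, Summable.tsum_add (summable_of_hasFiniteSupport hsA) (summable_of_hasFiniteSupport hsB),
    Summable.tsum_add (summable_of_hasFiniteSupport hsA) (summable_of_hasFiniteSupport hsC),
    tsum_sum_comp_sub_e hsg]

/-- **Summation by parts, degree `3 → 2`**: `⟪∂Q, M⟫₂ = ⟪Q, d₂M⟫₃` for a finitely supported totally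
alternating real 3-chain `Q` and any 2-tensor `M`. [cite: FrohlichSpencerCMP1982, §2.3 (2.15)] -/
theorem pair₂_div₃ {Q : Site d → Fin d → Fin d → Fin d → ℝ} (hQ : HasFiniteSupport Q)
    (halt : IsAltR₃ Q) (M : Site d → Fin d → Fin d → ℝ) : pair₂ (div₃ Q) M = pair₃ Q (d₂ M) := by
  set A : Site d → ℝ := fun y => ∑ j, ∑ k, ∑ l, Q y j k l * M y k l with hA
  set g : Fin d → Site d → ℝ := fun j z => ∑ k, ∑ l, Q z j k l * M (z + e j) k l with hg
  have hsA : HasFiniteSupport A := hasFiniteSupport_of_imp hQ fun y h0 => by simp [hA, h0]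
  have hsg : ∀ j, HasFiniteSupport (g j) := fun j => hasFiniteSupport_of_imp hQ fun y h0 => by
    simp [hg, h0]
  have hsC : HasFiniteSupport fun y => ∑ j, g j y :=
    hasFiniteSupport_of_imp hQ fun y h0 => by simp [hg, h0]
  have hsB : HasFiniteSupport fun y => ∑ j, g j (y - e j) :=
    hasFiniteSupport_of_imp_sub hQ fun y _ h1 => Finset.sum_eq_zero fun j _ => by simp [hg, h1 j]
  -- the right side: expand `d₂` and rename indices
  have hR : pair₃ Q (d₂ M) = (1 / 2) * ∑' y, (∑ j, g j y - A y) := by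
    unfold pair₃
    have h6 : (1 / 6 : ℝ) = (1 / 2) * (1 / 3) := by norm_num
    rw [h6, mul_assoc, ← tsum_mul_left]
    congr 1
    refine tsum_congr fun y => ?_
    have h1 : ∑ j, ∑ k, ∑ l, Q y j k l * d₂ M y j k l =
        (∑ j, ∑ k, ∑ l, Q y j k l * M (y + e j) k l - ∑ j, ∑ k, ∑ l, Q y j k l * M y k l) -
        (∑ j, ∑ k, ∑ l, Q y j k l * M (y + e k) j l - ∑ j, ∑ k, ∑ l, Q y j k l * M y j l) +
        (∑ j, ∑ k, ∑ l, Q y j k l * M (y + e l) j k - ∑ j, ∑ k, ∑ l, Q y j k l * M y j k) := by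
      simp only [LatticeForm.d₂, mul_add, mul_sub, Finset.sum_add_distrib, Finset.sum_sub_distrib]
    have h2 := sum₃_swap₁₂ halt y (fun a b c => M (y + e a) b c)
    have h3 := sum₃_swap₁₂ halt y (fun _ b c => M y b c)
    have h4 := sum₃_cyclic' halt y (fun a b c => M (y + e a) b c)
    have h5 := sum₃_cyclic' halt y (fun _ b c => M y b c)
    rw [h1, h2, h3, h4, h5]
    simp only [hA, hg]
    ring
  -- the left side
  have hL : pair₂ (div₃ Q) M = (1 / 2) * ∑' y, (∑ j, g j (y - e j) - A y) := by
    unfold pair₂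
    congr 1
    refine tsum_congr fun y => ?_
    have h1 : ∑ k, ∑ l, div₃ Q y k l * M y k l =
        ∑ k, ∑ l, ∑ j, Q (y - e j) j k l * M y k l - ∑ k, ∑ l, ∑ j, Q y j k l * M y k l := by
      simp only [LatticeChain.div₃, Finset.sum_mul, sub_mul, Finset.sum_sub_distrib]
    have hfront : ∀ R : Fin d → Fin d → Fin d → ℝ,
        ∑ k, ∑ l, ∑ j, R j k l = ∑ j, ∑ k, ∑ l, R j k l := by
      intro R
      have s : ∀ k, ∑ l, ∑ j, R j k l = ∑ j, ∑ l, R j k l := fun k => Finset.sum_comm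
      simp only [s]
      exact Finset.sum_comm
    have h2 : ∑ k, ∑ l, ∑ j, Q y j k l * M y k l = A y := by
      rw [hA]
      exact hfront (fun j k l => Q y j k l * M y k l)
    have h3 : ∑ k, ∑ l, ∑ j, Q (y - e j) j k l * M y k l = ∑ j, g j (y - e j) := by
      rw [hfront (fun j k l => Q (y - e j) j k l * M y k l)]
      refine Finset.sum_congr rfl fun j _ => ?_
      simp only [hg, sub_add_cancel]
    rw [h1, h2, h3]
  rw [hL, hR, Summable.tsum_sub (summable_of_hasFiniteSupport hsB) (summable_of_hasFiniteSupport hsA),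
    Summable.tsum_sub (summable_of_hasFiniteSupport hsC) (summable_of_hasFiniteSupport hsA),
    tsum_sum_comp_sub_e hsg]

/-- `cd₃` of a totally alternating 3-tensor is totally alternating. [folklore] -/
theorem isAltR₄_cd₃ {Q : Site d → Fin d → Fin d → Fin d → ℝ} (h : IsAltR₃ Q) : IsAltR₄ (cd₃ Q) := by
  refine ⟨fun y i j k l => ?_, fun y i j k l => ?_, fun y i j k l => ?_⟩
  · simp only [LatticeChain.cd₃]
    rw [h.1 (y + e k) i j l, h.1 y i j l, h.1 (y + e l) i j k, h.1 y i j k]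
    ring
  · simp only [LatticeChain.cd₃]
    rw [h.1 (y + e i) j k l, h.1 y j k l, h.2 (y + e l) i j k, h.2 y i j k]
    ring
  · simp only [LatticeChain.cd₃]
    rw [h.2 (y + e i) j k l, h.2 y j k l, h.2 (y + e j) i k l, h.2 y i k l]
    ring

/-- **Summation by parts, degree `4 → 3`**: `⟪∂P, Q⟫₃ = ⟪P, cd₃Q⟫₄` for a finitely supported totally
alternating real 4-chain `P` and any 3-tensor `Q`. [cite: FrohlichSpencerCMP1982, §2.3 (2.15)] -/
theorem pair₃_div₄ {P : Site d → Fin d → Fin d → Fin d → Fin d → ℝ} (hP : HasFiniteSupport P)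
    (halt : IsAltR₄ P) (Q : Site d → Fin d → Fin d → Fin d → ℝ) :
    pair₃ (div₄ P) Q = pair₄ P (cd₃ Q) := by
  set A : Site d → ℝ := fun y => ∑ i, ∑ j, ∑ k, ∑ l, P y i j k l * Q y j k l with hA
  set g : Fin d → Site d → ℝ := fun i z => ∑ j, ∑ k, ∑ l, P z i j k l * Q (z + e i) j k l with hg
  have hsA : HasFiniteSupport A := hasFiniteSupport_of_imp hP fun y h0 => by simp [hA, h0]
  have hsg : ∀ i, HasFiniteSupport (g i) := fun i => hasFiniteSupport_of_imp hP fun y h0 => by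
    simp [hg, h0]
  have hsC : HasFiniteSupport fun y => ∑ i, g i y :=
    hasFiniteSupport_of_imp hP fun y h0 => by simp [hg, h0]
  have hsB : HasFiniteSupport fun y => ∑ i, g i (y - e i) :=
    hasFiniteSupport_of_imp_sub hP fun y _ h1 => Finset.sum_eq_zero fun i _ => by simp [hg, h1 i]
  -- index renamings for the four groups of `cd₃`
  have hperm : ∀ (y : Site d) (F : Fin d → Fin d → Fin d → Fin d → ℝ),
      (∑ i, ∑ j, ∑ k, ∑ l, P y i j k l * F j i k l = -∑ i, ∑ j, ∑ k, ∑ l, P y i j k l * F i j k l) ∧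
      (∑ i, ∑ j, ∑ k, ∑ l, P y i j k l * F k i j l = ∑ i, ∑ j, ∑ k, ∑ l, P y i j k l * F i j k l) ∧
      (∑ i, ∑ j, ∑ k, ∑ l, P y i j k l * F l i j k = -∑ i, ∑ j, ∑ k, ∑ l, P y i j k l * F i j k l) := by
    intro y F
    have e1 : ∀ G : Fin d → Fin d → Fin d → Fin d → ℝ,
        ∑ i, ∑ j, ∑ k, ∑ l, P y i j k l * G j i k l = -∑ i, ∑ j, ∑ k, ∑ l, P y i j k l * G i j k l :=
      fun G => sum₄_swap₁₂ halt y G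
    have e2 : ∀ G : Fin d → Fin d → Fin d → Fin d → ℝ,
        ∑ i, ∑ j, ∑ k, ∑ l, P y i j k l * G i k j l = -∑ i, ∑ j, ∑ k, ∑ l, P y i j k l * G i j k l :=
      fun G => sum₄_swap₂₃ halt y G
    have e3 : ∀ G : Fin d → Fin d → Fin d → Fin d → ℝ,
        ∑ i, ∑ j, ∑ k, ∑ l, P y i j k l * G i j l k = -∑ i, ∑ j, ∑ k, ∑ l, P y i j k l * G i j k l :=
      fun G => sum₄_swap₃₄ halt y G
    -- (i,j,k,l) ↦ (k,i,j,l): first `swap₂₃` with G(a,b,c,d) = F(b,a,c,d), then `swap₁₂`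
    have c3 : ∑ i, ∑ j, ∑ k, ∑ l, P y i j k l * F k i j l = ∑ i, ∑ j, ∑ k, ∑ l, P y i j k l * F i j k l := by
      have s1 := e2 (fun a b c d' => F b a c d')
      have s2 := e1 F
      rw [s1, s2, neg_neg]
    refine ⟨e1 F, c3, ?_⟩
    -- (i,j,k,l) ↦ (l,i,j,k): `swap₃₄` with H(a,b,c,d) = F(c,a,b,d), then the cyclic one
    have s1 := e3 (fun a b c d' => F c a b d')
    rw [s1]
    have c3' : ∑ i, ∑ j, ∑ k, ∑ l, P y i j k l * F k i j l = ∑ i, ∑ j, ∑ k, ∑ l, P y i j k l * F i j k l := c3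
    rw [c3']
  have hR : pair₄ P (cd₃ Q) = (1 / 6) * ∑' y, (∑ i, g i y - A y) := by
    unfold pair₄
    have h24 : (1 / 24 : ℝ) = (1 / 6) * (1 / 4) := by norm_num
    rw [h24, mul_assoc, ← tsum_mul_left]
    congr 1
    refine tsum_congr fun y => ?_
    have h1 : ∑ i, ∑ j, ∑ k, ∑ l, P y i j k l * cd₃ Q y i j k l =
        (∑ i, ∑ j, ∑ k, ∑ l, P y i j k l * Q (y + e i) j k l - ∑ i, ∑ j, ∑ k, ∑ l, P y i j k l * Q y j k l) -
        (∑ i, ∑ j, ∑ k, ∑ l, P y i j k l * Q (y + e j) i k l - ∑ i, ∑ j, ∑ k, ∑ l, P y i j k l * Q y i k l) +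
        (∑ i, ∑ j, ∑ k, ∑ l, P y i j k l * Q (y + e k) i j l - ∑ i, ∑ j, ∑ k, ∑ l, P y i j k l * Q y i j l) -
        (∑ i, ∑ j, ∑ k, ∑ l, P y i j k l * Q (y + e l) i j k - ∑ i, ∑ j, ∑ k, ∑ l, P y i j k l * Q y i j k) := by
      simp only [LatticeChain.cd₃, mul_add, mul_sub, Finset.sum_add_distrib, Finset.sum_sub_distrib]
    obtain ⟨a1, a2, a3⟩ := hperm y (fun a b c d' => Q (y + e a) b c d')
    obtain ⟨b1, b2, b3⟩ := hperm y (fun _ b c d' => Q y b c d')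
    rw [h1, a1, a2, a3, b1, b2, b3]
    simp only [hA, hg]
    ring
  have hL : pair₃ (div₄ P) Q = (1 / 6) * ∑' y, (∑ i, g i (y - e i) - A y) := by
    unfold pair₃
    congr 1
    refine tsum_congr fun y => ?_
    have h1 : ∑ j, ∑ k, ∑ l, div₄ P y j k l * Q y j k l =
        ∑ j, ∑ k, ∑ l, ∑ i, P (y - e i) i j k l * Q y j k l - ∑ j, ∑ k, ∑ l, ∑ i, P y i j k l * Q y j k l := by
      simp only [LatticeChain.div₄, Finset.sum_mul, sub_mul, Finset.sum_sub_distrib]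
    -- move the innermost index `i` to the front
    have hfront : ∀ (R : Fin d → Fin d → Fin d → Fin d → ℝ),
        ∑ j, ∑ k, ∑ l, ∑ i, R i j k l = ∑ i, ∑ j, ∑ k, ∑ l, R i j k l := by
      intro R
      have s3 : ∀ j k, ∑ l, ∑ i, R i j k l = ∑ i, ∑ l, R i j k l := fun j k => Finset.sum_comm
      simp only [s3]
      have s2 : ∀ j, ∑ k, ∑ i, ∑ l, R i j k l = ∑ i, ∑ k, ∑ l, R i j k l := fun j => Finset.sum_comm
      simp only [s2]
      exact Finset.sum_comm
    have h2 : ∑ j, ∑ k, ∑ l, ∑ i, P y i j k l * Q y j k l = A y := by rw [hA, hfront]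
    have h3 : ∑ j, ∑ k, ∑ l, ∑ i, P (y - e i) i j k l * Q y j k l = ∑ i, g i (y - e i) := by
      rw [hfront]
      refine Finset.sum_congr rfl fun i _ => ?_
      simp only [hg, sub_add_cancel]
    rw [h1, h2, h3]
  rw [hL, hR, Summable.tsum_sub (summable_of_hasFiniteSupport hsB) (summable_of_hasFiniteSupport hsA),
    Summable.tsum_sub (summable_of_hasFiniteSupport hsC) (summable_of_hasFiniteSupport hsA),
    tsum_sum_comp_sub_e hsg]

/-! ### The Dirichlet energy of a 3-chain and the variational bound -/

/-- **The Dirichlet energy of a 3-chain splits**: `⟪f, -Δf⟫₃ = ⟪∂f, ∂f⟫₂ + ⟪cd₃ f, cd₃ f⟫₄` for a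
finitely supported totally alternating real 3-chain (pair the Hodge identity
`-Δf = ∂(cd₃ f) + d₂(∂f)` with `f` and sum by parts). [cite: FrohlichSpencerCMP1982, §2.5 (2.35) with §2.3 (2.15)] -/
theorem energy₃_eq {f : Site d → Fin d → Fin d → Fin d → ℝ} (hf : HasFiniteSupport f)
    (halt : IsAltR₃ f) :
    pair₃ f (negLap₃ f) = pair₂ (div₃ f) (div₃ f) + pair₄ (cd₃ f) (cd₃ f) := by
  rw [← div₄_cd₃_add_d₂_div₃ f, pair₃_add_right hf, pair₃_comm f (div₄ (cd₃ f)),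
    pair₃_div₄ (hasFiniteSupport_cd₃ hf) (isAltR₄_cd₃ halt), ← pair₂_div₃ hf halt (div₃ f), add_comm]

/-- `‖∂f‖² ≤ ⟪f, -Δf⟫₃` for a finitely supported totally alternating real 3-chain. [folklore] -/
theorem pair₂_div₃_self_le_energy₃ {f : Site d → Fin d → Fin d → Fin d → ℝ} (hf : HasFiniteSupport f)
    (halt : IsAltR₃ f) : pair₂ (div₃ f) (div₃ f) ≤ pair₃ f (negLap₃ f) := by
  rw [energy₃_eq hf halt]
  exact le_add_of_nonneg_right (pair₄_self_nonneg _)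

/-- **The variational bound.** For a finitely supported alternating real 2-chain `σ` and a
finitely supported totally alternating real 3-chain `f`:
`⟪σ - ∂f, σ - ∂f⟫₂ ≤ ⟪σ, σ⟫₂ - (2 ⟪f, d₂σ⟫₃ - ⟪f, -Δf⟫₃)`. Applied to the sheet `σ` of a Wilson
loop and to test 3-chains `f` supported in the region, the left side dominates the minimal energy
`(ε_Λ, ε_Λ)` of Fröhlich–Spencer (2.51), (2.88). [cite: FrohlichSpencerCMP1982, §2.7 (2.50)–(2.52), §2.10 (2.88)] -/
theorem pair₂_sub_div₃_self_le {σ : Site d → Fin d → Fin d → ℝ} (hσ : HasFiniteSupport σ)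
    {f : Site d → Fin d → Fin d → Fin d → ℝ} (hf : HasFiniteSupport f) (halt : IsAltR₃ f) :
    pair₂ (σ - div₃ f) (σ - div₃ f) ≤
      pair₂ σ σ - (2 * pair₃ f (d₂ σ) - pair₃ f (negLap₃ f)) := by
  have hdf := hasFiniteSupport_div₃ hf
  have hexp : pair₂ (σ - div₃ f) (σ - div₃ f) =
      pair₂ σ σ - 2 * pair₂ (div₃ f) σ + pair₂ (div₃ f) (div₃ f) := by
    rw [pair₂_sub_right (hσ.sub hdf), pair₂_comm (σ - div₃ f) σ, pair₂_comm (σ - div₃ f) (div₃ f),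
      pair₂_sub_right hσ, pair₂_sub_right hdf, pair₂_comm σ (div₃ f)]
    ring
  rw [hexp, pair₂_div₃ hf halt σ]
  linarith [pair₂_div₃_self_le_energy₃ hf halt]

end LatticeChain

end Literature.MathematicalPhysics.QuantumFieldTheory
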